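import Summits.SmoothPoincare4.SmoothPoincare4.Theses.CongruenceShadows
import Literature.Topology.FourManifolds.TrisectionFunctorGK
import Literature.Topology.FourManifolds.SphereTrisections
import Literature.Topology.FourManifolds.FreeFundamentalGroupThreeManifold
import Literature.Topology.FourManifolds.LickorishTwistSurgery

/-!
# Sketch (crux-ideate, ideator 1, round 1) — WaldhausenPairs (stmt-SmoothPoincare4-14592)

First lemmas of three idea cards, stated over EXISTING declarations, plus the sorry-free
reductions that show how each first lemma plugs into the crux.

* Card `agk-realization-device`: `GKPairStandard` and
  `waldhausenPairs_of_realization : (e′).{0} → GKPairStandard → WaldhausenPairs` (sorry-free).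
* Card `zieschang-orbit-dnb-regluing`: `HandlebodyKernelsOneOrbit` (W1, algebraic) and
  `PairRegluing` (the geometric step it feeds); `waldhausenPairs_of_W1_regluing` (sorry-free).
* Card `jaco-splitting-homomorphism`: `HeegaardPairOrbit'` entry point of the common tail is the
  refuter's `HeegaardPairOrbit` (Disproof.lean §C); the device is `JacoPairRealization` (typed).
-/

set_option linter.dupNamespace false

noncomputable section

open scoped Manifold ContDiff
open Literature.Topology.FourManifolds Subgroup
open Summit.SmoothPoincare4.SmoothPoincare4.Theses.CongruenceShadows (WaldhausenPairs)

namespace Summit.SmoothPoincare4.SmoothPoincare4.Cruxes.WaldhausenPairs.SketchIdeator1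

/-! ## Card 1 — realization by AGK's map ℳ (tree fact (e′)) -/

/-- FIRST LEMMA of card 1: the `(i,j)` Heegaard pair of a balanced `(3+3m, m+1)` Gay–Kirby
trisection of a closed connected oriented smooth 4-manifold is standard (Waldhausen 1968 for
`∂X_l = H_i ∪_F H_j ≅ #ᵏ S¹×S²`, plus π₁-transport). Perelman-free. -/
def GKPairStandard : Prop :=
  ∀ (X : Type) [TopologicalSpace X] [T2Space X] [SecondCountableTopology X]
    [ChartedSpace (EuclideanSpace ℝ (Fin 4)) X] [IsManifold (𝓡 4) ∞ X] [CompactSpace X]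
    [ConnectedSpace X] (_ : SmoothOrientation (𝓡 4) X) (m : ℕ) (S : Fin 3 → Set X)
    (h : IsBalancedGKTrisection X (3 + 3 * m) (m + 1) S) (x₀ : centralSurface S)
    (μ : SurfaceGroup (3 + 3 * m) ≃* FundamentalGroup (centralSurface S) x₀),
    ∀ i j : Fin 3, i ≠ j →
      ∃ α : SurfaceGroup (3 + 3 * m) ≃* SurfaceGroup (3 + 3 * m),
        (s4Kernels.stabilizeIter m i).map α.toMonoidHom = groupGKTrisectionOf h x₀ μ i ∧
        (s4Kernels.stabilizeIter m j).map α.toMonoidHom = groupGKTrisectionOf h x₀ μ j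

/-- REDUCTION (sorry-free): AGK realization (e′) at universe 0 + `GKPairStandard` ⇒ the crux.
The kernel triple `K` is realized by a trisected `X` (this consumes ALL of `IsGroupTrisection`,
honouring `waldhausenPairs_false_without_pairFree` / `_false_without_freeQuotient`), re-marked to
equality, and the simultaneous `α` comes from the geometric pair (honouring `not_pairTransfer`). -/
theorem waldhausenPairs_of_realization
    (he : exists_gkTrisected_of_isGroupTrisection.{0}) (hP : GKPairStandard) :
    WaldhausenPairs := by
  intro m K hK i j hij
  obtain ⟨X, _, _, _, _, _, _, _, o, S, hS, x₀, μ, hiso⟩ := he (3 + 3 * m) (m + 1) PUnit K hK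
  obtain ⟨μ', hμ'⟩ := exists_marking_groupGKTrisectionOf_eq hS x₀ μ hiso
  obtain ⟨α, hαi, hαj⟩ := hP X o m S hS x₀ μ' i j hij
  exact ⟨α, hαi.trans (congrFun hμ' i), hαj.trans (congrFun hμ' j)⟩

/-! ## Card 2 — algebraic single-orbit theorem (W1) + regluing of the standard model -/

/-- FIRST LEMMA of card 2 (W1, Zieschang 1964/65 – Grigorchuk–Kurchanov 1990, ALGEBRAIC: Nielsen's
method for the quadratic relator): any two normal subgroups of `S_g` with quotient free of rank
`g` ("handlebody kernels") differ by an automorphism of `S_g`. Pure `PresentedGroup` statement. -/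
def HandlebodyKernelsOneOrbit (g : ℕ) : Prop :=
  ∀ A B : Subgroup (SurfaceGroup g), A.Normal → B.Normal →
    IsFreeOfRank (SurfaceGroup g ⧸ normalClosure (A : Set (SurfaceGroup g))) g →
    IsFreeOfRank (SurfaceGroup g ⧸ normalClosure (B : Set (SurfaceGroup g))) g →
    ∃ α : SurfaceGroup g ≃* SurfaceGroup g, A.map α.toMonoidHom = B

/-- The geometric step W1 feeds (card 2): REGLUING. For the standard pair `(N_i, N_j)` and ANY
automorphism `ρ` such that the reglued pair `(N_i, ρ N_j)` still has pair quotient free of rank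
`m+1`, the reglued pair is standard. (Proof route: realize `ρ` by a diffeomorphism of the central
surface of the standard trisection of `S⁴` — Dehn–Nielsen–Baer, the ONE new fact — glue the two
standard handlebodies along it (`exists_isBoundaryGluing_holds`), van Kampen (tree), then the
tree's `heegaardSplittings_diffeomorphic_of_isFreeOfRank` and π₁-transport.) -/
def PairRegluing : Prop :=
  ∀ (m : ℕ) (i j : Fin 3), i ≠ j →
    ∀ ρ : SurfaceGroup (3 + 3 * m) ≃* SurfaceGroup (3 + 3 * m),
      IsFreeOfRank (SurfaceGroup (3 + 3 * m) ⧸ normalClosure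
        ((s4Kernels.stabilizeIter m i : Set (SurfaceGroup (3 + 3 * m))) ∪
          (s4Kernels.stabilizeIter m j).map ρ.toMonoidHom)) (m + 1) →
      ∃ σ : SurfaceGroup (3 + 3 * m) ≃* SurfaceGroup (3 + 3 * m),
        (s4Kernels.stabilizeIter m i).map σ.toMonoidHom = s4Kernels.stabilizeIter m i ∧
        (s4Kernels.stabilizeIter m j).map σ.toMonoidHom =
          (s4Kernels.stabilizeIter m j).map ρ.toMonoidHom

/-- The standard triple is a group trisection at every `m` (as in Disproof.lean §0′). -/
theorem stabilizeIter_isGroupTrisection (m : ℕ) :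
    IsGroupTrisection (3 + 3 * m) (m + 1) (PUnit : Type) (s4Kernels.stabilizeIter m) := by
  induction m with
  | zero => exact s4Kernels_isGroupTrisection_holds
  | succ m ih => exact stabilize_isGroupTrisection_holds _ _ _ _ ih

/-- Transport of the pair quotient along an automorphism: `S ⧸ ⟪αA ∪ αB⟫ ≅ S ⧸ ⟪A ∪ B⟫`. -/
theorem isFreeOfRank_pairQuotient_map {g k : ℕ} (A B : Subgroup (SurfaceGroup g))
    (α : SurfaceGroup g ≃* SurfaceGroup g)
    (h : IsFreeOfRank (SurfaceGroup g ⧸ normalClosure ((A : Set (SurfaceGroup g)) ∪ B)) k) :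
    IsFreeOfRank (SurfaceGroup g ⧸ normalClosure
      ((A.map α.toMonoidHom : Set (SurfaceGroup g)) ∪ B.map α.toMonoidHom)) k := by
  have hset : ((A.map α.toMonoidHom : Set (SurfaceGroup g)) ∪ B.map α.toMonoidHom) =
      α.toMonoidHom '' ((A : Set (SurfaceGroup g)) ∪ B) := by
    rw [Set.image_union]; rfl
  have hnc : normalClosure ((A.map α.toMonoidHom : Set (SurfaceGroup g)) ∪ B.map α.toMonoidHom) =
      (normalClosure ((A : Set (SurfaceGroup g)) ∪ B)).map α.toMonoidHom := by
    rw [hset, Subgroup.map_normalClosure _ _ α.surjective]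
  refine h.of_mulEquiv ((QuotientGroup.congr _ _ α ?_))
  rw [hnc]; rfl

/-- `(α.trans β)` as a monoid hom is the composite. [folklore] -/
theorem toMonoidHom_trans {G : Type*} [Group G] (α β : G ≃* G) :
    (α.trans β).toMonoidHom = β.toMonoidHom.comp α.toMonoidHom :=
  MonoidHom.ext fun _ => rfl

/-- Mapping a subgroup along `α.trans β` is mapping along `α` then `β`. [folklore] -/
theorem map_trans {G : Type*} [Group G] (A : Subgroup G) (α β : G ≃* G) :
    A.map (α.trans β).toMonoidHom = (A.map α.toMonoidHom).map β.toMonoidHom := by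
  rw [toMonoidHom_trans, Subgroup.map_map]

/-- Mapping along `α` then `α⁻¹` is the identity. [folklore] -/
theorem map_map_symm {G : Type*} [Group G] (A : Subgroup G) (α : G ≃* G) :
    (A.map α.toMonoidHom).map α.symm.toMonoidHom = A := by
  rw [← map_trans, MulEquiv.self_trans_symm]
  have : (MulEquiv.refl G).toMonoidHom = MonoidHom.id G := MonoidHom.ext fun _ => rfl
  rw [this, Subgroup.map_id]

/-- REDUCTION (sorry-free): W1 at genus `3+3m` + `PairRegluing` ⇒ the crux. W1 standardises `K_i`
and `K_j` SEPARATELY (`K_i = α_i N_i`, `K_j = α_j N_j`); the pair becomes `(N_i, ρ N_j)` with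
`ρ = α_j` followed by `α_i⁻¹`, whose pair quotient is still free of rank `m+1` (transport);
`PairRegluing` then gives the SIMULTANEOUS `σ` (this is where `not_pairTransfer` is honoured:
`σ ≠ 1` in general, i.e. `α ≠ α_i`). -/
theorem waldhausenPairs_of_W1_regluing
    (hW1 : ∀ m, HandlebodyKernelsOneOrbit (3 + 3 * m)) (hR : PairRegluing) :
    WaldhausenPairs := by
  intro m K hK i j hij
  have hN := stabilizeIter_isGroupTrisection m
  obtain ⟨αi, hαi⟩ := hW1 m (s4Kernels.stabilizeIter m i) (K i) (hN.normal i) (hK.normal i)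
    (hN.free_quotient i) (hK.free_quotient i)
  obtain ⟨αj, hαj⟩ := hW1 m (s4Kernels.stabilizeIter m j) (K j) (hN.normal j) (hK.normal j)
    (hN.free_quotient j) (hK.free_quotient j)
  -- the pair (N i, ρ N j), ρ := αj then αi⁻¹, is the image of (K i, K j) under αi⁻¹
  have hKi : (K i).map αi.symm.toMonoidHom = s4Kernels.stabilizeIter m i := by
    rw [← hαi, map_map_symm]
  have hKj : (K j).map αi.symm.toMonoidHom =
      (s4Kernels.stabilizeIter m j).map (αj.trans αi.symm).toMonoidHom := by
    rw [← hαj, map_trans]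
  have hfree : IsFreeOfRank (SurfaceGroup (3 + 3 * m) ⧸ normalClosure
      ((s4Kernels.stabilizeIter m i : Set (SurfaceGroup (3 + 3 * m))) ∪
        (s4Kernels.stabilizeIter m j).map (αj.trans αi.symm).toMonoidHom)) (m + 1) := by
    have := isFreeOfRank_pairQuotient_map (K i) (K j) αi.symm (hK.free_pairQuotient i j hij)
    rwa [hKi, hKj] at this
  obtain ⟨σ, hσi, hσj⟩ := hR m i j hij (αj.trans αi.symm) hfree
  -- α := σ then αi
  refine ⟨σ.trans αi, ?_, ?_⟩
  · rw [map_trans, hσi, hαi]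
  · rw [map_trans, hσj, ← map_trans]
    have : ((αj.trans αi.symm).trans αi).toMonoidHom = αj.toMonoidHom :=
      MonoidHom.ext fun x => by simp
    rw [this, hαj]

/-! ## Card 3 — Jaco's splitting-homomorphism realization (Hempel Lemma 14.5) -/

/-- FIRST LEMMA of card 3 (the DEVICE, manifold form, Perelman-free; Jaco 1969 = Hempel Lemma 14.5:
"every map `φ₁ × φ₂ : π₁(T) → F_g × F_g` with `φ₁`, `φ₂` epic is equivalent to a splitting
homomorphism associated with a Heegaard splitting of some closed orientable 3-manifold").
Kernel form over the tree's relational Heegaard vocabulary: a pair of handlebody kernels `(A, B)`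
of `S_g` is the kernel pair of a genus-`g` Heegaard splitting `Y = H₁ ∪_f H₂`, read on `∂H₁`
through a marking `μ`. -/
def JacoPairRealization : Prop :=
  ∀ (g : ℕ) (A B : Subgroup (SurfaceGroup g)), A.Normal → B.Normal →
    IsFreeOfRank (SurfaceGroup g ⧸ normalClosure (A : Set (SurfaceGroup g))) g →
    IsFreeOfRank (SurfaceGroup g ⧸ normalClosure (B : Set (SurfaceGroup g))) g →
    ∃ (H₁ : Type) (_ : TopologicalSpace H₁) (_ : ChartedSpace (EuclideanHalfSpace 3) H₁)
      (_ : IsManifold (𝓡∂ 3) ∞ H₁)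
      (H₂ : Type) (_ : TopologicalSpace H₂) (_ : ChartedSpace (EuclideanHalfSpace 3) H₂)
      (_ : IsManifold (𝓡∂ 3) ∞ H₂)
      (b₁ : BoundaryData (𝓡∂ 3) H₁ (𝓡 2)) (b₂ : BoundaryData (𝓡∂ 3) H₂ (𝓡 2))
      (f : b₁.carrier ≃ₘ⟮𝓡 2, 𝓡 2⟯ b₂.carrier)
      (Y : Type) (_ : TopologicalSpace Y) (_ : T2Space Y) (_ : SecondCountableTopology Y)
      (_ : ChartedSpace (EuclideanSpace ℝ (Fin 3)) Y) (_ : IsManifold (𝓡 3) ∞ Y)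
      (_ : CompactSpace Y) (_ : ConnectedSpace Y) (_ : IsOrientable (𝓡 3) Y)
      (j₁ : H₁ → Y) (j₂ : H₂ → Y) (_ : IsHandlebody g H₁) (_ : IsHandlebody g H₂)
      (_ : IsBoundaryGluingWith b₁ b₂ f (𝓡 3) j₁ j₂)
      (x : b₁.carrier) (μ : SurfaceGroup g ≃* FundamentalGroup b₁.carrier x),
      A = (FundamentalGroup.map ⟨b₁.incl, b₁.continuous_incl⟩ x).ker.comap μ.toMonoidHom ∧
      B = (FundamentalGroup.map ⟨b₂.incl ∘ f, b₂.continuous_incl.comp f.continuous⟩ x).ker.comap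
        μ.toMonoidHom

/-- Entry point of the COMMON TAIL shared by cards 2 and 3 (the refuter's `HeegaardPairOrbit`,
Disproof.lean §C, restated here verbatim so this file is self-contained): ordered Heegaard pairs
of type `(g,k)` form one `Aut(S_g)`-orbit. Card 3 = `JacoPairRealization` + van Kampen (tree) +
`heegaardSplittings_diffeomorphic_of_isFreeOfRank` (tree) + π₁-transport ⇒ this, at
`(g,k) = (3+3m, m+1)`; then Disproof.lean's `waldhausenPairs_of_heegaardPairOrbit`. -/
def HeegaardPairOrbit (g k : ℕ) : Prop :=
  ∀ A B A' B' : Subgroup (SurfaceGroup g), A.Normal → B.Normal → A'.Normal → B'.Normal →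
    IsFreeOfRank (SurfaceGroup g ⧸ normalClosure (A : Set (SurfaceGroup g))) g →
    IsFreeOfRank (SurfaceGroup g ⧸ normalClosure (B : Set (SurfaceGroup g))) g →
    IsFreeOfRank (SurfaceGroup g ⧸ normalClosure (A' : Set (SurfaceGroup g))) g →
    IsFreeOfRank (SurfaceGroup g ⧸ normalClosure (B' : Set (SurfaceGroup g))) g →
    IsFreeOfRank (SurfaceGroup g ⧸ normalClosure ((A : Set (SurfaceGroup g)) ∪ B)) k →
    IsFreeOfRank (SurfaceGroup g ⧸ normalClosure ((A' : Set (SurfaceGroup g)) ∪ B')) k →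
    ∃ α : SurfaceGroup g ≃* SurfaceGroup g, A.map α.toMonoidHom = A' ∧ B.map α.toMonoidHom = B'

theorem waldhausenPairs_of_heegaardPairOrbit (h : ∀ m, HeegaardPairOrbit (3 + 3 * m) (m + 1)) :
    WaldhausenPairs := by
  intro m K hK i j hij
  have hN := stabilizeIter_isGroupTrisection m
  exact h m (s4Kernels.stabilizeIter m i) (s4Kernels.stabilizeIter m j) (K i) (K j)
    (hN.normal i) (hN.normal j) (hK.normal i) (hK.normal j)
    (hN.free_quotient i) (hN.free_quotient j) (hK.free_quotient i) (hK.free_quotient j)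
    (hN.free_pairQuotient i j hij) (hK.free_pairQuotient i j hij)

end Summit.SmoothPoincare4.SmoothPoincare4.Cruxes.WaldhausenPairs.SketchIdeator1

end
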